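import Summits.AnomalousDissipation.AnomalousDissipation.Theorems.RelaxingFamily.Negative.FiniteEnstrophy
import Summits.AnomalousDissipation.AnomalousDissipation.Theorems.RelaxingFamily.Negative.SublogBudget
import HarnessLib

/-!
# Negative knowledge for the crux `RelaxingFamily` (stmt-AnomalousDissipation-15009), V: per-level
# exclusions at infinitely many levels

Corollaries of the subsequence principle (`RelaxingFamilyUnder.subseq`,
`relaxingFamilyUnder_frequently_imp`, `Negative/SublogBudget.lean`) for the per-level classes of
`Negative/LinearEnstrophyBudget.lean` and `Negative/FiniteEnstrophy.lean` (supports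
stmt-AnomalousDissipation-15009): a witness of the crux cannot have, at infinitely many levels,
finite total enstrophy dissipation, nor (with one bound `Z`) bounded enstrophy from some phase on.
-/

noncomputable section

open MeasureTheory Set Filter Function TopologicalSpace Topology
open scoped ENNReal NNReal InnerProductSpace

namespace Summit.AnomalousDissipation.AnomalousDissipation.Theorems.RelaxingFamily.Negative

-- D-0017: single-problem summit ⇒ `Summit.AnomalousDissipation.AnomalousDissipation.…` by design.
set_option linter.dupNamespace false

open Literature.Analysis.FunctionSpaces Literature.Analysis.FunctionSpaces.Torus
open Literature.Analysis.FluidPDE Literature.Analysis.FluidPDE.Torus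
open Summit.AnomalousDissipation.AnomalousDissipation.Theses.LimitingAbsorption

/-- **Finite total enstrophy at infinitely many levels is excluded.** [cite: Seis2022, Remark 1 (arXiv:2003.08794 p. 4)] -/
theorem relaxingFamily_false_without_infiniteEnstrophyDissipation_frequently :
    ¬ RelaxingFamilyUnder fun _g _h _ν v =>
      ∃ᶠ j in atTop, ∫⁻ t in Ioi (0 : ℝ), eGradNormSq (v j t) ≠ ⊤ :=
  relaxingFamilyUnder_frequently_imp
    (P := fun _ _ _ (w : ℝ → UnitAddTorus (Fin 2) → EuclideanSpace ℝ (Fin 2)) =>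
      ∫⁻ t in Ioi (0 : ℝ), eGradNormSq (w t) ≠ ⊤)
    relaxingFamily_false_without_infiniteEnstrophyDissipation

/-- **Bounded enstrophy (one bound `Z`) from some phase on, at infinitely many levels, is excluded.**
[cite: Seis2022, Thm 2 (arXiv:2003.08794 pp. 3–4)] -/
theorem relaxingFamily_false_without_unboundedEnstrophy_frequently :
    ¬ RelaxingFamilyUnder fun _g _h _ν v => ∃ Z : ℝ, ∃ᶠ j in atTop, ∃ s : ℝ, 0 ≤ s ∧
      (∃ M' : ℝ≥0, ∀ᵐ t ∂(volume.restrict (Ioi (0 : ℝ))), ∫⁻ x, ‖v j (s + t) x‖ₑ ^ 2 ≤ M') ∧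
      ∀ᵐ t ∂(volume.restrict (Ioi (0 : ℝ))), eGradNormSq (v j (s + t)) ≤ ENNReal.ofReal Z := by
  intro hf
  refine relaxingFamily_false_without_unboundedEnstrophy (hf.subseq fun g h ν v _ _ ⟨Z, hfr⟩ => ?_)
  obtain ⟨φ, hφ, hP⟩ := extraction_of_frequently_atTop hfr
  exact ⟨φ, hφ, Z, fun j => hP j⟩

end Summit.AnomalousDissipation.AnomalousDissipation.Theorems.RelaxingFamily.Negative

end
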